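import Literature.Geometry.Lorentzian.CarterHorizonPocket
import HarnessLib

/-!
# The `|ξ| ≥ 1` horizon pocket of Carter's equation WITHOUT the cosmetic hypothesis `Λ ≥ 1`
(namespace `Literature.Geometry.Lorentzian.Kerr`.)

Companion of `CarterHorizonPocket.lean`. There the flux-free a priori bound for the `𝓗⁺`-normalised
solution of Carter's equation `u″ + (ω² − V∘ρ)u = 0` on the pocket `ρ − r₊ ≤ c₁|σ|(r₊² + a²)`,
`ρ − r₊ ≤ M` (`σ = ω − mω₊`, `|ξ| ≥ 1`, i.e. `r₊ − r₋ ≤ |σ|(r₊² + a²)`) is proved for admissible triples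
with `Λ ≥ 1`, a hypothesis entering ONLY through the upper bound of the coefficient
`ω² − V ≤ ω² + 6Λ/M²` (`Kerr.coeff_le_of_admissible`: `|V| ≤ 3Λ/r² + 3M/r³ ≤ 3Λ/M² + 3/M²`, and
`3/M² ≤ 3Λ/M²` iff `Λ ≥ 1`). For `m ≠ 0` admissibility forces `Λ ≥ 2`, but in the axisymmetric window
`m = 0` every `Λ ≥ 0` is admissible. Here the pocket is re-run with an angular CEILING `Λ₁ ≥ max(Λ, 1)` in
place of `Λ` in the ratio: `Φ = ω² + 6Λ₁/M²`.

* `coeff_le_of_admissible_lowLambda` — `ω² − V(r) ≤ ω² + 6Λ₁/M²` on `r ≥ r₊` (`Λ ≤ Λ₁`, `1 ≤ Λ₁`);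
* `horizonPocket_soninEnergy_le_lowLambda`, `horizonPocket_normSq_le_lowLambda` — the Sonin bounds on
  the pocket for `𝓗⁺` data: `φ‖u‖² + ‖u′‖² ≤ 3σ²(800Φ/σ²)^8`, `‖u‖² ≤ 2400(800Φ/σ²)^8`,
  `‖u′‖² ≤ 3σ²(800Φ/σ²)^8`;
* `horizonPocket_weightedNormSq_le_lowLambda` — the same for the TdC-normalised radial function `R_𝓗` in
  the `r`-variable.

The proofs are those of `CarterHorizonPocket.lean` verbatim with `coeff_le_of_admissible` replaced by
`coeff_le_of_admissible_lowLambda`; this closes the axisymmetric low-`Λ` window of the off-cone envelope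
(`TeukolskyOffConeSupBoundsAxisymmetric.lean`).

## References
* M. Dafermos, I. Rodnianski, Y. Shlapentokh-Rothman, arXiv:1402.7034 = Ann. of Math. 183 (2016),
  §5.2.3, Lemma 6.3.2, §8 (key `DafermosRodnianskiShlapentokhrothman2014`).
* G. Szegő, *Orthogonal Polynomials*, §7.31 (Sonin–Pólya).
-/

noncomputable section

open Filter Set
open scoped _root_.Topology

namespace Literature.Geometry.Lorentzian

namespace Kerr

/-- **Upper bound of Carter's coefficient with an angular ceiling**: `ω² − V(r) ≤ ω² + 6Λ₁/M²` on
`r ≥ r₊` for an admissible triple with `Λ ≤ Λ₁`, `1 ≤ Λ₁` (`|V| ≤ 3Λ/r² + 3M/r³ ≤ 3Λ₁/M² + 3Λ₁/M²`).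
No hypothesis `Λ ≥ 1`. [cite: DafermosRodnianskiShlapentokhrothman2014, §8.4] -/
theorem coeff_le_of_admissible_lowLambda {M a ω Λ Λ₁ : ℝ} {m : ℤ} (hM : 0 < M) (haM : |a| ≤ M)
    (hadm : IsAdmissibleTriple a ω m Λ) (hΛ : Λ ≤ Λ₁) (h1 : 1 ≤ Λ₁) {r : ℝ} (hr : rPlus M a ≤ r) :
    ω ^ 2 - sepPotential M a ω m Λ r ≤ ω ^ 2 + 6 * Λ₁ / M ^ 2 := by
  have hMr : M ≤ r := (M_le_rPlus M a).trans hr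
  have hr0 : 0 < r := hM.trans_le hMr
  have hΛ0 : 0 ≤ Λ := hadm.nonneg
  have hV := abs_sepPotential_le hM haM hadm hr
  have h1' : 3 * Λ / r ^ 2 ≤ 3 * Λ₁ / M ^ 2 :=
    div_le_div₀ (by positivity) (by linarith) (by positivity) (pow_le_pow_left₀ hM.le hMr 2)
  have h2 : 3 * M / r ^ 3 ≤ 3 / M ^ 2 := by
    rw [div_le_div_iff₀ (by positivity) (by positivity)]
    have : M ^ 3 ≤ r ^ 3 := pow_le_pow_left₀ hM.le hMr 3
    nlinarith
  have h3 : 3 * Λ₁ / M ^ 2 + 3 / M ^ 2 ≤ 6 * Λ₁ / M ^ 2 := by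
    rw [← add_div]
    exact div_le_div_of_nonneg_right (by linarith) (by positivity)
  have : -(sepPotential M a ω m Λ r) ≤ 3 * Λ / r ^ 2 + 3 * M / r ^ 3 := by
    have := (abs_le.1 hV).1
    linarith
  linarith

/-! ### Sonin bounds on the pocket for the solution with `𝓗⁺` data, `Λ ≤ Λ₁`, `1 ≤ Λ₁` -/

section Pocket

variable {M a ω Λ Λ₁ c₁ : ℝ} {m : ℤ} {ρ : ℝ → ℝ} {u u₁ : ℝ → ℂ}

/-- **Sonin energy on the `|ξ| ≥ 1` pocket, `𝓗⁺` data, no `Λ ≥ 1`.** Let `u″ + (ω² − V(ρ x))u = 0`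
along a tortoise radius (`|a| < M`, admissible triple with `Λ ≤ Λ₁`, `1 ≤ Λ₁`), with `‖u‖ → 1`,
`‖u′‖ → |σ|` at `−∞` (`σ = ω − mω₊`), and let `c₁`, `σ` be as in `coeff_lower_of_horizonPocket`. Then at
every `y` with `ρ y − r₊ ≤ c₁|σ|(r₊² + a²)` and `ρ y − r₊ ≤ M`:
`(ω² − V(ρ y))‖u y‖² + ‖u′ y‖² ≤ (Φ/(σ²/800))^8 · 3σ²`, `Φ = ω² + 6Λ₁/M²`. [folklore] -/
theorem horizonPocket_soninEnergy_le_lowLambda (hρ : IsTortoiseRadius M a ρ) (hMa : IsSubextremal M a)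
    (hadm : IsAdmissibleTriple a ω m Λ) (hΛ : Λ ≤ Λ₁) (h1 : 1 ≤ Λ₁) (hc₀ : 0 < c₁) (hc₁ : c₁ ≤ 1)
    (hcω : 10 * M * |ω| * c₁ ≤ 1) (hcΛ : 16 * (2 * Λ + 3) * c₁ ≤ 1)
    (hσ : rPlus M a - rMinus M a ≤ |ω - m * horizonAngularVelocity M a| * (rPlus M a ^ 2 + a ^ 2))
    (hu : ∀ x, HasDerivAt u (u₁ x) x ∧
      HasDerivAt u₁ (-(((ω ^ 2 - sepPotential M a ω m Λ (ρ x) : ℝ) : ℂ) * u x)) x)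
    (hlim : Tendsto (fun x ↦ ‖u x‖) atBot (𝓝 1))
    (hlim₁ : Tendsto (fun x ↦ ‖u₁ x‖) atBot (𝓝 |ω - m * horizonAngularVelocity M a|)) {y : ℝ}
    (hy₁ : ρ y - rPlus M a ≤ c₁ * |ω - m * horizonAngularVelocity M a| * (rPlus M a ^ 2 + a ^ 2))
    (hyM : ρ y - rPlus M a ≤ M) :
    (ω ^ 2 - sepPotential M a ω m Λ (ρ y)) * ‖u y‖ ^ 2 + ‖u₁ y‖ ^ 2 ≤
      ((ω ^ 2 + 6 * Λ₁ / M ^ 2) / ((ω - m * horizonAngularVelocity M a) ^ 2 / 800)) ^ 8 *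
        (3 * (ω - m * horizonAngularVelocity M a) ^ 2) := by
  have hM : 0 < M := hMa.pos
  have haM : |a| ≤ M := le_of_lt hMa
  set σ := ω - m * horizonAngularVelocity M a with hσ_def
  set Φ := ω ^ 2 + 6 * Λ₁ / M ^ 2 with hΦ_def
  set φ : ℝ → ℝ := fun s ↦ ω ^ 2 - sepPotential M a ω m Λ (ρ s) with hφ_def
  -- `σ ≠ 0` (from `0 < r₊ − r₋ ≤ |σ|(r₊² + a²)`)
  have hd : 0 < rPlus M a - rMinus M a := sub_pos.2 hMa.rMinus_lt_rPlus
  have hσ0 : 0 < |σ| := by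
    by_contra h
    push Not at h
    have : |σ| = 0 := le_antisymm h (abs_nonneg σ)
    rw [this, zero_mul] at hσ
    linarith
  have hσ2 : 0 < σ ^ 2 := by rw [← sq_abs]; positivity
  have hmin : 0 < σ ^ 2 / 800 := by positivity
  -- the coefficient on `(−∞, y]` lies in `[σ²/800, Φ]`
  have hzone : ∀ s, s ≤ y → σ ^ 2 / 800 ≤ φ s ∧ φ s ≤ Φ := by
    intro s hs
    have hmono : ρ s ≤ ρ y := (hρ.strictMono hMa).monotone hs
    refine ⟨coeff_lower_of_horizonPocket hM haM hadm hc₀ hc₁ hcω hcΛ hσ (hρ.rPlus_lt s).le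
      (by linarith) (by linarith), ?_⟩
    exact coeff_le_of_admissible_lowLambda hM haM hadm hΛ h1 (hρ.rPlus_lt s).le
  -- the energy tends to `2σ²` at `−∞`, hence is eventually `≤ 3σ²`
  have hT : Tendsto (fun x ↦ φ x * ‖u x‖ ^ 2 + ‖u₁ x‖ ^ 2) atBot (𝓝 (2 * σ ^ 2)) := by
    have h := ((hρ.tendsto_coeff_atBot hMa ω m Λ).mul (hlim.pow 2)).add (hlim₁.pow 2)
    have e : σ ^ 2 * 1 ^ 2 + |σ| ^ 2 = 2 * σ ^ 2 := by rw [one_pow, mul_one, sq_abs]; ring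
    rw [e] at h
    exact h
  have hev : ∀ᶠ x in atBot, φ x * ‖u x‖ ^ 2 + ‖u₁ x‖ ^ 2 ≤ 3 * σ ^ 2 :=
    hT.eventually (eventually_le_nhds (by nlinarith : 2 * σ ^ 2 < 3 * σ ^ 2))
  obtain ⟨x, hxT, hxy⟩ := (hev.and (eventually_le_atBot y)).exists
  -- the ratio `Φ/(σ²/800) ≥ 1`
  have hratio : 1 ≤ Φ / (σ ^ 2 / 800) := by
    rw [le_div_iff₀ hmin, one_mul]
    exact (hzone y le_rfl).1.trans (hzone y le_rfl).2
  rcases eq_or_lt_of_le hxy with hxy' | hxy'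
  · -- `x = y`
    subst hxy'
    have h38 : (1 : ℝ) ≤ (Φ / (σ ^ 2 / 800)) ^ 8 := one_le_pow₀ hratio
    have hT0 : 0 ≤ φ x * ‖u x‖ ^ 2 + ‖u₁ x‖ ^ 2 :=
      add_nonneg (mul_nonneg (hmin.le.trans (hzone x le_rfl).1) (sq_nonneg _)) (sq_nonneg _)
    calc φ x * ‖u x‖ ^ 2 + ‖u₁ x‖ ^ 2 ≤ 3 * σ ^ 2 := hxT
      _ = 1 * (3 * σ ^ 2) := (one_mul _).symm
      _ ≤ (Φ / (σ ^ 2 / 800)) ^ 8 * (3 * σ ^ 2) := by gcongr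
  obtain ⟨k, t, hk, ht0, htk, hmono_t, hmono⟩ := hρ.exists_monotone_partition hMa hadm hxy'
  have hbd : ∀ s ∈ Icc (t 0) (t k), σ ^ 2 / 800 ≤ φ s ∧ φ s ≤ Φ := by
    intro s hs
    rw [htk] at hs
    exact hzone s hs.2
  have hxI : x ∈ Icc (t 0) (t k) := by rw [ht0, htk]; exact left_mem_Icc.2 hxy
  have hyI : y ∈ Icc (t 0) (t k) := by rw [ht0, htk]; exact right_mem_Icc.2 hxy
  have key := Literature.Analysis.ODE.soninEnergy_le_pow_ratio (u := u) (u' := u₁) (φ := φ)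
    (φ' := fun s ↦ -(deriv (sepPotential M a ω m Λ) (ρ s) * (delta M a (ρ s) / (ρ s ^ 2 + a ^ 2))))
    (φmin := σ ^ 2 / 800) (φmax := Φ) t hmono_t
    (fun s _ ↦ ⟨(hu s).1, by simpa only [hφ_def] using (hu s).2⟩)
    (fun s _ ↦ hρ.hasDerivAt_omega_sq_sub_sepPotential hMa ω m Λ s) hmono hmin hbd hxI hyI
  have hr0 : 0 ≤ Φ / (σ ^ 2 / 800) := zero_le_one.trans hratio
  have hTx : 0 ≤ φ x * ‖u x‖ ^ 2 + ‖u₁ x‖ ^ 2 :=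
    add_nonneg (mul_nonneg (hmin.le.trans (hzone x hxy).1) (sq_nonneg _)) (sq_nonneg _)
  calc φ y * ‖u y‖ ^ 2 + ‖u₁ y‖ ^ 2 ≤ (Φ / (σ ^ 2 / 800)) ^ k * (φ x * ‖u x‖ ^ 2 + ‖u₁ x‖ ^ 2) := key
    _ ≤ (Φ / (σ ^ 2 / 800)) ^ 8 * (φ x * ‖u x‖ ^ 2 + ‖u₁ x‖ ^ 2) :=
        mul_le_mul_of_nonneg_right (pow_le_pow_right₀ hratio hk) hTx
    _ ≤ (Φ / (σ ^ 2 / 800)) ^ 8 * (3 * σ ^ 2) := by gcongr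

/-- Consequences on the `|ξ| ≥ 1` pocket (`𝓗⁺` data, `Λ ≤ Λ₁`, `1 ≤ Λ₁`):
`‖u y‖² ≤ 2400·(Φ/(σ²/800))^8` and `‖u′ y‖² ≤ 3σ²·(Φ/(σ²/800))^8`, `Φ = ω² + 6Λ₁/M²` (divide the
energy bound by `φ ≥ σ²/800`). [folklore] -/
theorem horizonPocket_normSq_le_lowLambda (hρ : IsTortoiseRadius M a ρ) (hMa : IsSubextremal M a)
    (hadm : IsAdmissibleTriple a ω m Λ) (hΛ : Λ ≤ Λ₁) (h1 : 1 ≤ Λ₁) (hc₀ : 0 < c₁) (hc₁ : c₁ ≤ 1)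
    (hcω : 10 * M * |ω| * c₁ ≤ 1) (hcΛ : 16 * (2 * Λ + 3) * c₁ ≤ 1)
    (hσ : rPlus M a - rMinus M a ≤ |ω - m * horizonAngularVelocity M a| * (rPlus M a ^ 2 + a ^ 2))
    (hu : ∀ x, HasDerivAt u (u₁ x) x ∧
      HasDerivAt u₁ (-(((ω ^ 2 - sepPotential M a ω m Λ (ρ x) : ℝ) : ℂ) * u x)) x)
    (hlim : Tendsto (fun x ↦ ‖u x‖) atBot (𝓝 1))
    (hlim₁ : Tendsto (fun x ↦ ‖u₁ x‖) atBot (𝓝 |ω - m * horizonAngularVelocity M a|)) {y : ℝ}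
    (hy₁ : ρ y - rPlus M a ≤ c₁ * |ω - m * horizonAngularVelocity M a| * (rPlus M a ^ 2 + a ^ 2))
    (hyM : ρ y - rPlus M a ≤ M) :
    ‖u y‖ ^ 2 ≤ 2400 *
        ((ω ^ 2 + 6 * Λ₁ / M ^ 2) / ((ω - m * horizonAngularVelocity M a) ^ 2 / 800)) ^ 8 ∧
      ‖u₁ y‖ ^ 2 ≤ 3 * (ω - m * horizonAngularVelocity M a) ^ 2 *
        ((ω ^ 2 + 6 * Λ₁ / M ^ 2) / ((ω - m * horizonAngularVelocity M a) ^ 2 / 800)) ^ 8 := by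
  have hM : 0 < M := hMa.pos
  have haM : |a| ≤ M := le_of_lt hMa
  set σ := ω - m * horizonAngularVelocity M a with hσ_def
  set P := ((ω ^ 2 + 6 * Λ₁ / M ^ 2) / (σ ^ 2 / 800)) ^ 8 with hP_def
  have hE := horizonPocket_soninEnergy_le_lowLambda hρ hMa hadm hΛ h1 hc₀ hc₁ hcω hcΛ hσ hu hlim hlim₁
    hy₁ hyM
  have hφ : σ ^ 2 / 800 ≤ ω ^ 2 - sepPotential M a ω m Λ (ρ y) :=
    coeff_lower_of_horizonPocket hM haM hadm hc₀ hc₁ hcω hcΛ hσ (hρ.rPlus_lt y).le hy₁ hyM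
  have hd : 0 < rPlus M a - rMinus M a := sub_pos.2 hMa.rMinus_lt_rPlus
  have hσ0 : 0 < |σ| := by
    by_contra h
    push Not at h
    have : |σ| = 0 := le_antisymm h (abs_nonneg σ)
    rw [this, zero_mul] at hσ
    linarith
  have hσ2 : 0 < σ ^ 2 := by rw [← sq_abs]; positivity
  have hP0 : 0 ≤ P := by
    have h1' : 0 ≤ (ω ^ 2 + 6 * Λ₁ / M ^ 2) / (σ ^ 2 / 800) :=
      div_nonneg (le_trans (by positivity) (hφ.trans
        (coeff_le_of_admissible_lowLambda hM haM hadm hΛ h1 (hρ.rPlus_lt y).le))) (by positivity)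
    positivity
  have hu2 : 0 ≤ ‖u₁ y‖ ^ 2 := sq_nonneg _
  have hf : 0 ≤ ‖u y‖ ^ 2 := sq_nonneg _
  refine ⟨?_, ?_⟩
  · have h1' : σ ^ 2 / 800 * ‖u y‖ ^ 2 ≤ P * (3 * σ ^ 2) := by
      nlinarith [mul_le_mul_of_nonneg_right hφ hf]
    by_contra hcon
    push Not at hcon
    nlinarith
  · nlinarith [mul_nonneg (le_trans (by positivity) hφ) hf]

end Pocket

/-! ### The same bound for the TdC-normalised radial function `R_𝓗`, in the `r`-variable -/

/-- **A priori bound for `R_𝓗` on the `|ξ| ≥ 1` pocket, no `Λ ≥ 1`.** Let `0 < M`, `|a| < M`,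
`(ω, m, Λ)` admissible with `Λ ≤ Λ₁`, `1 ≤ Λ₁`, `σ = ω − mω₊`, `0 < c₁ ≤ 1` with `10M|ω|c₁ ≤ 1`,
`16(2Λ + 3)c₁ ≤ 1`, and `r₊ − r₋ ≤ |σ|(r₊² + a²)`. For every classical solution `R` of the scalar radial
Teukolsky ODE (`λ = Λ − a²ω²`) normalised at `𝓗⁺` as in Teixeira da Costa's Def. 2.3 and every `r > r₊`
with `r − r₊ ≤ c₁|σ|(r₊² + a²)`, `r − r₊ ≤ M`:
`(√(r² + a²)‖R r‖)² ≤ 2400(Φ/(σ²/800))^8` and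
`((Δ/(r² + a²))‖(√(·² + a²)R)′(r)‖)² ≤ 3σ²(Φ/(σ²/800))^8`, `Φ = ω² + 6Λ₁/M²`. [folklore] -/
theorem horizonPocket_weightedNormSq_le_lowLambda {M a ω Λ Λ₁ c₁ : ℝ} {m : ℤ} (hM : 0 < M)
    (ha : |a| < M) (hadm : IsAdmissibleTriple a ω m Λ) (hΛ : Λ ≤ Λ₁) (h1 : 1 ≤ Λ₁) (hc₀ : 0 < c₁)
    (hc₁ : c₁ ≤ 1) (hcω : 10 * M * |ω| * c₁ ≤ 1) (hcΛ : 16 * (2 * Λ + 3) * c₁ ≤ 1)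
    (hσ : rPlus M a - rMinus M a ≤ |ω - m * horizonAngularVelocity M a| * (rPlus M a ^ 2 + a ^ 2))
    {R : ℝ → ℂ} (hR : IsRadialTeukolskySolution M a 0 ω m (Λ - a ^ 2 * ω ^ 2) R)
    (hn : IsNormalisedHorizonSolution M a 0 ω m R) {r : ℝ} (hr : rPlus M a < r)
    (hr₁ : r - rPlus M a ≤ c₁ * |ω - m * horizonAngularVelocity M a| * (rPlus M a ^ 2 + a ^ 2))
    (hrM : r - rPlus M a ≤ M) :
    (Real.sqrt (r ^ 2 + a ^ 2) * ‖R r‖) ^ 2 ≤ 2400 *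
        ((ω ^ 2 + 6 * Λ₁ / M ^ 2) / ((ω - m * horizonAngularVelocity M a) ^ 2 / 800)) ^ 8 ∧
      (delta M a r / (r ^ 2 + a ^ 2) *
          ‖deriv (fun s : ℝ ↦ ((Real.sqrt (s ^ 2 + a ^ 2) : ℝ) : ℂ) * R s) r‖) ^ 2 ≤
        3 * (ω - m * horizonAngularVelocity M a) ^ 2 *
          ((ω ^ 2 + 6 * Λ₁ / M ^ 2) / ((ω - m * horizonAngularVelocity M a) ^ 2 / 800)) ^ 8 := by
  have hsub : IsSubextremal M a := ha
  obtain ⟨ρ, hρ⟩ := exists_isTortoiseRadius hsub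
  obtain ⟨y, hy⟩ := hρ.exists_apply_eq hr
  obtain ⟨u₁, u₂, hu⟩ := schrodingerForm hM ha hR hρ
  set u : ℝ → ℂ := fun x ↦ ((Real.sqrt (ρ x ^ 2 + a ^ 2) : ℝ) : ℂ) * R (ρ x) with hu_def
  have hu' : ∀ x, HasDerivAt u (u₁ x) x ∧
      HasDerivAt u₁ (-(((ω ^ 2 - sepPotential M a ω m Λ (ρ x) : ℝ) : ℂ) * u x)) x := by
    intro x
    obtain ⟨h1', h2, h3, -⟩ := hu x
    refine ⟨h1', ?_⟩
    rwa [eq_neg_of_add_eq_zero_left h3] at h2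
  have hu₁ : ∀ x, u₁ x = ((delta M a (ρ x) / (ρ x ^ 2 + a ^ 2) : ℝ) : ℂ) *
      deriv (fun s : ℝ ↦ ((Real.sqrt (s ^ 2 + a ^ 2) : ℝ) : ℂ) * R s) (ρ x) := fun x ↦ (hu x).2.2.2
  have hnorm : ∀ x, ‖u x‖ = Real.sqrt (ρ x ^ 2 + a ^ 2) * ‖R (ρ x)‖ := fun x ↦ by
    simp only [hu_def, norm_mul, Complex.norm_of_nonneg (Real.sqrt_nonneg _)]
  have hnorm₁ : ∀ x, ‖u₁ x‖ = delta M a (ρ x) / (ρ x ^ 2 + a ^ 2) *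
      ‖deriv (fun s : ℝ ↦ ((Real.sqrt (s ^ 2 + a ^ 2) : ℝ) : ℂ) * R s) (ρ x)‖ := fun x ↦ by
    rw [hu₁ x, norm_mul, Complex.norm_of_nonneg (hρ.deriv_pos hsub x).le]
  -- horizon data along `ρ → r₊⁺`
  have hbot : Tendsto ρ atBot (𝓝[>] rPlus M a) := hρ.tendsto_nhdsGT
  have hlim : Tendsto (fun x ↦ ‖u x‖) atBot (𝓝 1) := by
    have h := (Costa2019.tendsto_norm_horizonSolution hn).comp hbot
    exact h.congr fun x ↦ (hnorm x).symm
  have hlim₁ : Tendsto (fun x ↦ ‖u₁ x‖) atBot (𝓝 |ω - m * horizonAngularVelocity M a|) := by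
    have h := (Costa2019.tendsto_norm_deriv_horizonSolution hM ha hn).comp hbot
    exact h.congr fun x ↦ (hnorm₁ x).symm
  have key := horizonPocket_normSq_le_lowLambda hρ hsub hadm hΛ h1 hc₀ hc₁ hcω hcΛ hσ hu' hlim hlim₁
    (y := y) (by rw [hy]; exact hr₁) (by rw [hy]; exact hrM)
  rw [hnorm y, hnorm₁ y, hy] at key
  exact key

end Kerr

end Literature.Geometry.Lorentzian

end
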